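import Mathlib
import Summits.NavierStokesRegularity.NavierStokesRegularity.Theorems.TaoLadderRungTwoBreakBlowupRigidityOneEnergyBound
import HarnessLib

/-!
# ENERGY CONSERVATION for the exact cascade flow of a cancelling table up to the blow-up time:
  `Σ_{k} ‖x_k(t)‖² = Σ_i X₀ᵢ²` for every `t < T` (as a `HasSum` over the shells), with the explicit
  geometric rate `|Σ_{k ≤ K} ‖x_k(t)‖² - Σ_i X₀ᵢ²| ≤ C(t) (Λ/(1+ε₀)^{10})^K` — companion of
  `…EnergyBound` (support for K2(1) `TaoLadderRungTwoBreak.BlowupRigidityOne`, stmt-NavierStokesRegularity-20206)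

MODEL lattice ODEs only (Tao 2016 §4 (4.3), Lemma 4.1 (4.5), (4.9)–(4.10): `⟨C(u,u),u⟩ = 0`); nothing here
is a statement about the Navier–Stokes equations; NO item is closed (`--supports stmt-NavierStokesRegularity-20206`).
Route-independent; general `m`.

* `abs_partialEnergy_sub_datumEnergy_le` — the two-sided telescoping estimate (same proof as
  `partialEnergy_le_datumEnergy`, keeping both sides of the mean-value bound on the top flux);
* `energy_hasSum` — **energy conservation**: along an exact flow from the one-shell datum `X₀` (no shells
  below `0`, (4.5)-regular on every `[0,T']`, `T' < T`) the shell energies are summable at every `t < T`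
  with sum `Σ_i X₀ᵢ²`; in particular along the maximal exact flow of a robustly blowing-up table
  (`energy_hasSum_of_noGlobalCascade`) the energy is conserved up to the blow-up time `T⋆` while the
  critical amplitude blows up (`criticalBlowup_of_noGlobalCascade`).
-/

noncomputable section

-- the summit and its single sub-problem share the name (CONVENTIONS §1)
set_option linter.dupNamespace false

open Set Filter Topology Finset
open scoped RealInnerProductSpace

namespace Summit.NavierStokesRegularity.NavierStokesRegularity.Theorems

namespace BlowupRigidityOne

open Literature.Analysis.FluidPDE Literature.Analysis.FluidPDE.TaoCascade
open DSSOneShift (hasDerivWithinAt_shellVec shellVec_quadTerm_normalForm norm_shellVec_le_sqrt_mul)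

variable {m : ℕ}

/-- **TWO-SIDED TELESCOPING ESTIMATE.** For an exact flow of a cancelling table from the one-shell datum
`X₀` at shell `0` (derivatives within `[0,∞)`, no shells below `0`, (4.5)-regular on every `[0,T']`,
`T' < T`), at every `t < T` there is `C ≥ 0` with
`|Σ_{k=0}^{K} ‖x_k(t)‖² - Σ_i X₀ᵢ²| ≤ C · (Λ/(1+ε₀)^{10})^K` for all `K` (`Λ = bigLam ε₀ < (1+ε₀)^{10}`).
[cite: Tao2016AveragedNS, §4 (4.3), Lemma 4.1 (4.5), (4.9)–(4.10)] -/
theorem abs_partialEnergy_sub_datumEnergy_le {ε₀ T : ℝ} (hε : 0 < ε₀)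
    {α : Fin m → Fin m → Fin m → ℤ × ℤ × ℤ → ℝ} (hc : IsCancellingCoeff α)
    {X : Fin m → ℤ → ℝ → ℝ} {X₀ : Fin m → ℝ}
    (hder : ∀ i k, ∀ t ∈ Ico 0 T, HasDerivWithinAt (X i k) (quadTerm ε₀ α X i k t) (Ici 0) t)
    (hinit : ∀ i k, X i k 0 = if k = 0 then X₀ i else 0)
    (hlow : ∀ i k t, k < 0 → X i k t = 0)
    (hreg : ∀ T' : ℝ, T' < T → ∃ M : ℝ, ∀ t ∈ Icc 0 T', ∀ (i : Fin m) (k : ℤ),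
      (1 + (1 + ε₀) ^ ((10 : ℝ) * k)) * |X i k t| ≤ M) :
    ∀ t ∈ Ico 0 T, ∃ C : ℝ, 0 ≤ C ∧ ∀ K : ℕ,
      |∑ k ∈ Finset.range (K + 1), ‖shellVec X (k : ℤ) t‖ ^ 2 - ∑ i, X₀ i ^ 2| ≤
        C * (bigLam ε₀ / (1 + ε₀) ^ (10 : ℝ)) ^ K := by
  intro t ht
  have hl0 : (0 : ℝ) < 1 + ε₀ := by linarith
  have hl1 : (1 : ℝ) < 1 + ε₀ := by linarith
  have hL : 0 < bigLam ε₀ := bigLam_pos (by linarith)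
  have hS := table_sTable α hc
  obtain ⟨M₀, hM₀⟩ := hreg t ht.2
  set M : ℝ := max M₀ 0 with hMdef
  have hM : ∀ τ ∈ Icc (0 : ℝ) t, ∀ (i : Fin m) (k : ℤ), (1 + (1 + ε₀) ^ ((10 : ℝ) * k)) * |X i k τ| ≤ M :=
    fun τ hτ i k => (hM₀ τ hτ i k).trans (le_max_left _ _)
  have hM0 : 0 ≤ M := le_max_right _ _
  -- the flux `f k τ = 2 Λ^k ⟪x_{k+1}, A x_k⟫`
  set f : ℤ → ℝ → ℝ := fun k τ =>
    2 * bigLam ε₀ ^ k * ⟪shellVec X (k + 1) τ, tableA α (shellVec X k τ)⟫ with hfdef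
  -- partial energies
  set S : ℕ → ℝ → ℝ := fun K' τ => ∑ k ∈ Finset.range (K' + 1), ‖shellVec X (k : ℤ) τ‖ ^ 2 with hSdef
  -- the shells below `0` vanish, so `f (-1) = 0`
  have hxneg : ∀ τ, shellVec X (-1) τ = 0 := fun τ => by
    ext i; simp [shellVec, hlow i (-1) τ (by norm_num)]
  have hfneg : ∀ τ, f (-1) τ = 0 := fun τ => by
    simp only [hfdef]
    rw [hxneg, tableA_zero hc, inner_zero_right, mul_zero]
  -- derivative of the partial energy: telescoping
  have hSder : ∀ K' : ℕ, ∀ τ ∈ Icc (0 : ℝ) t,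
      HasDerivWithinAt (S K') (-(f K' τ)) (Ici 0) τ := by
    intro K' τ hτ
    have hτT : τ ∈ Ico (0 : ℝ) T := ⟨hτ.1, lt_of_le_of_lt hτ.2 ht.2⟩
    have hterm : ∀ k ∈ Finset.range (K' + 1), HasDerivWithinAt (fun s => ‖shellVec X (k : ℤ) s‖ ^ 2)
        (f ((k : ℤ) - 1) τ - f k τ) (Ici 0) τ := by
      intro k _
      have h := shellEnergy_hasDerivWithinAt hε hc (k := (k : ℤ)) (fun i => hder i k τ hτT)
      simp only [hfdef, sub_add_cancel]
      exact h
    have hsum := HasDerivWithinAt.sum hterm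
    have htel : ∑ k ∈ Finset.range (K' + 1), (f ((k : ℤ) - 1) τ - f k τ) = -(f K' τ) := by
      have h := Finset.sum_range_sub' (fun k : ℕ => f ((k : ℤ) - 1) τ) (K' + 1)
      have e : ∀ k : ℕ, f (((k + 1 : ℕ) : ℤ) - 1) τ = f (k : ℤ) τ := fun k => by
        congr 1; push_cast; ring
      simp only [e] at h
      rw [h]
      push_cast
      rw [hfneg, zero_sub]
    rw [htel, Finset.sum_fn] at hsum
    exact hsum
  -- bound on the top flux via the a priori weight
  have hW1 : ∀ k : ℤ, (1 : ℝ) ≤ 1 + (1 + ε₀) ^ ((10 : ℝ) * k) := fun k => by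
    linarith [Real.rpow_nonneg hl0.le ((10 : ℝ) * k)]
  have hcomp : ∀ τ ∈ Icc (0 : ℝ) t, ∀ (i : Fin m) (k : ℤ), |X i k τ| ≤ M / (1 + (1 + ε₀) ^ ((10 : ℝ) * k)) :=
    fun τ hτ i k => by
      rw [le_div_iff₀ (lt_of_lt_of_le one_pos (hW1 k)), mul_comm]; exact hM τ hτ i k
  have hxle : ∀ τ ∈ Icc (0 : ℝ) t, ∀ k : ℤ, ‖shellVec X k τ‖ ≤ Real.sqrt m * (M / (1 + (1 + ε₀) ^ ((10 : ℝ) * k))) :=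
    fun τ hτ k => norm_shellVec_le_sqrt_mul (div_nonneg hM0 (lt_of_lt_of_le one_pos (hW1 k)).le)
      (fun i => hcomp τ hτ i k)
  have hxle' : ∀ τ ∈ Icc (0 : ℝ) t, ∀ k : ℤ, ‖shellVec X k τ‖ ≤ Real.sqrt m * M := fun τ hτ k =>
    (hxle τ hτ k).trans (mul_le_mul_of_nonneg_left (div_le_self hM0 (hW1 k)) (Real.sqrt_nonneg _))
  -- the decay ratio `q = Λ / (1+ε₀)^10 < 1`
  set q : ℝ := bigLam ε₀ / (1 + ε₀) ^ (10 : ℝ) with hqdef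
  have hP10 : 0 < (1 + ε₀) ^ (10 : ℝ) := Real.rpow_pos_of_pos hl0 _
  have hq0 : 0 ≤ q := div_nonneg hL.le hP10.le
  have hq1 : q < 1 := by
    rw [hqdef, div_lt_one hP10]
    unfold bigLam
    exact Real.rpow_lt_rpow_of_exponent_lt hl1 (by norm_num)
  set Cf : ℝ := 2 * fluxConst α * (Real.sqrt m * M) ^ 3 with hCfdef
  have hCf0 : 0 ≤ Cf := by
    have := fluxConst_nonneg α
    positivity
  have hfbound : ∀ K' : ℕ, ∀ τ ∈ Icc (0 : ℝ) t, |f K' τ| ≤ Cf * q ^ K' := by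
    intro K' τ hτ
    have hA := hS.normA (shellVec X K' τ)
    have h1 : |⟪shellVec X ((K' : ℤ) + 1) τ, tableA α (shellVec X K' τ)⟫| ≤
        (Real.sqrt m * M) * (fluxConst α * (‖shellVec X (K' : ℤ) τ‖ * ‖shellVec X (K' : ℤ) τ‖)) := by
      refine (abs_real_inner_le_norm _ _).trans ?_
      rw [← sq]
      exact mul_le_mul (hxle' τ hτ _) hA (norm_nonneg _) (by positivity)
    -- one factor of `‖x_{K'}‖` carries the weight
    have h2 : ‖shellVec X (K' : ℤ) τ‖ * ‖shellVec X (K' : ℤ) τ‖ ≤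
        (Real.sqrt m * M) * (Real.sqrt m * (M / (1 + (1 + ε₀) ^ ((10 : ℝ) * ((K' : ℤ) : ℝ))))) :=
      mul_le_mul (hxle' τ hτ _) (hxle τ hτ _) (norm_nonneg _) (by positivity)
    have hW : ((1 + ε₀) ^ (10 : ℝ)) ^ K' ≤ 1 + (1 + ε₀) ^ ((10 : ℝ) * ((K' : ℤ) : ℝ)) := by
      have : ((1 + ε₀) ^ (10 : ℝ)) ^ K' = (1 + ε₀) ^ ((10 : ℝ) * ((K' : ℤ) : ℝ)) := by
        rw [← Real.rpow_natCast, ← Real.rpow_mul hl0.le]; push_cast; ring_nf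
      linarith
    have hW0 : 0 < ((1 + ε₀) ^ (10 : ℝ)) ^ K' := pow_pos hP10 _
    have h3 : M / (1 + (1 + ε₀) ^ ((10 : ℝ) * ((K' : ℤ) : ℝ))) ≤ M / ((1 + ε₀) ^ (10 : ℝ)) ^ K' :=
      div_le_div_of_nonneg_left hM0 hW0 hW
    have hΛK : bigLam ε₀ ^ ((K' : ℤ)) = bigLam ε₀ ^ K' := zpow_natCast _ _
    simp only [hfdef]
    rw [abs_mul, abs_mul, abs_two, hΛK, abs_of_pos (pow_pos hL _)]
    have hsm : 0 ≤ Real.sqrt m := Real.sqrt_nonneg _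
    calc 2 * bigLam ε₀ ^ K' * |⟪shellVec X ((K' : ℤ) + 1) τ, tableA α (shellVec X (K' : ℤ) τ)⟫|
        ≤ 2 * bigLam ε₀ ^ K' * ((Real.sqrt m * M) * (fluxConst α *
            ((Real.sqrt m * M) * (Real.sqrt m * (M / ((1 + ε₀) ^ (10 : ℝ)) ^ K'))))) := by
          refine mul_le_mul_of_nonneg_left (h1.trans ?_) (by positivity)
          refine mul_le_mul_of_nonneg_left (mul_le_mul_of_nonneg_left (h2.trans ?_)
            (fluxConst_nonneg α)) (by positivity)
          exact mul_le_mul_of_nonneg_left (mul_le_mul_of_nonneg_left h3 hsm) (by positivity)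
      _ = Cf * (bigLam ε₀ ^ K' / ((1 + ε₀) ^ (10 : ℝ)) ^ K') := by
          simp only [hCfdef]; field_simp
      _ = Cf * q ^ K' := by rw [hqdef, div_pow]
  -- the partial energy at time `0` is the datum energy
  have hS0 : ∀ K' : ℕ, S K' 0 = ∑ i, X₀ i ^ 2 := by
    intro K'
    simp only [hSdef]
    rw [Finset.sum_eq_single 0]
    · rw [EuclideanSpace.norm_eq, Real.sq_sqrt (Finset.sum_nonneg fun i _ => by positivity)]
      refine Finset.sum_congr rfl fun i _ => ?_
      simp [shellVec, hinit]
    · intro k _ hk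
      have : shellVec X (k : ℤ) 0 = 0 := by
        ext i
        simp [shellVec, hinit, hk]
      rw [this, norm_zero, zero_pow two_ne_zero]
    · intro h; exact absurd (Finset.mem_range.2 (Nat.succ_pos K')) h
  -- mean value: `|S K' t - S K' 0| ≤ Cf q^{K'} t`
  have hSt : ∀ K' : ℕ, S K' t ≤ ∑ i, X₀ i ^ 2 + Cf * q ^ K' * t := by
    intro K'
    have hd : ∀ τ ∈ Icc (0 : ℝ) t, HasDerivWithinAt (S K') (-(f K' τ)) (Icc 0 t) τ :=
      fun τ hτ => (hSder K' τ hτ).mono Icc_subset_Ici_self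
    have key := norm_image_sub_le_of_norm_deriv_le_segment' hd
      (fun τ hτ => by rw [norm_neg, Real.norm_eq_abs]; exact hfbound K' τ ⟨hτ.1, hτ.2.le⟩) t
      (right_mem_Icc.2 ht.1)
    rw [Real.norm_eq_abs, hS0, sub_zero] at key
    linarith [(abs_le.1 key).2]
  -- the two-sided bound, with `C = Cf · t`
  refine ⟨Cf * t, mul_nonneg hCf0 ht.1, fun K => ?_⟩
  have hd : ∀ τ ∈ Icc (0 : ℝ) t, HasDerivWithinAt (S K) (-(f K τ)) (Icc 0 t) τ :=
    fun τ hτ => (hSder K τ hτ).mono Icc_subset_Ici_self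
  have key := norm_image_sub_le_of_norm_deriv_le_segment' hd
    (fun τ hτ => by rw [norm_neg, Real.norm_eq_abs]; exact hfbound K τ ⟨hτ.1, hτ.2.le⟩) t
    (right_mem_Icc.2 ht.1)
  rw [Real.norm_eq_abs, hS0, sub_zero] at key
  calc |∑ k ∈ Finset.range (K + 1), ‖shellVec X (k : ℤ) t‖ ^ 2 - ∑ i, X₀ i ^ 2| = |S K t - ∑ i, X₀ i ^ 2| := rfl
    _ ≤ Cf * q ^ K * t := key
    _ = Cf * t * (bigLam ε₀ / (1 + ε₀) ^ (10 : ℝ)) ^ K := by rw [hqdef]; ring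

/-- **ENERGY CONSERVATION UP TO THE BLOW-UP TIME.** Under the same hypotheses, at every `t < T` the shell
energies `k ↦ ‖x_k(t)‖²` (`k ∈ ℕ`; shells below `0` vanish) are summable with sum `Σ_i X₀ᵢ²`.
[cite: Tao2016AveragedNS, §4 (4.3), Lemma 4.1 (4.5), (4.9)–(4.10)] -/
theorem energy_hasSum {ε₀ T : ℝ} (hε : 0 < ε₀)
    {α : Fin m → Fin m → Fin m → ℤ × ℤ × ℤ → ℝ} (hc : IsCancellingCoeff α)
    {X : Fin m → ℤ → ℝ → ℝ} {X₀ : Fin m → ℝ}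
    (hder : ∀ i k, ∀ t ∈ Ico 0 T, HasDerivWithinAt (X i k) (quadTerm ε₀ α X i k t) (Ici 0) t)
    (hinit : ∀ i k, X i k 0 = if k = 0 then X₀ i else 0)
    (hlow : ∀ i k t, k < 0 → X i k t = 0)
    (hreg : ∀ T' : ℝ, T' < T → ∃ M : ℝ, ∀ t ∈ Icc 0 T', ∀ (i : Fin m) (k : ℤ),
      (1 + (1 + ε₀) ^ ((10 : ℝ) * k)) * |X i k t| ≤ M) :
    ∀ t ∈ Ico 0 T, HasSum (fun k : ℕ => ‖shellVec X (k : ℤ) t‖ ^ 2) (∑ i, X₀ i ^ 2) := by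
  intro t ht
  have hl0 : (0 : ℝ) < 1 + ε₀ := by linarith
  have hl1 : (1 : ℝ) < 1 + ε₀ := by linarith
  obtain ⟨C, hC0, hC⟩ := abs_partialEnergy_sub_datumEnergy_le hε hc hder hinit hlow hreg t ht
  set q : ℝ := bigLam ε₀ / (1 + ε₀) ^ (10 : ℝ) with hqdef
  have hP10 : 0 < (1 + ε₀) ^ (10 : ℝ) := Real.rpow_pos_of_pos hl0 _
  have hq0 : 0 ≤ q := div_nonneg (bigLam_pos (by linarith)).le hP10.le
  have hq1 : q < 1 := by
    rw [hqdef, div_lt_one hP10]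
    unfold bigLam
    exact Real.rpow_lt_rpow_of_exponent_lt hl1 (by norm_num)
  rw [hasSum_iff_tendsto_nat_of_nonneg (fun k => by positivity)]
  -- partial sums over `range (K+1)` converge; shift the index by one
  have hK : Tendsto (fun K : ℕ => ∑ k ∈ Finset.range (K + 1), ‖shellVec X (k : ℤ) t‖ ^ 2) atTop
      (𝓝 (∑ i, X₀ i ^ 2)) := by
    rw [Metric.tendsto_atTop]
    intro ε hεp
    obtain ⟨N, hN⟩ := exists_pow_lt_of_lt_one (div_pos hεp (by linarith : (0 : ℝ) < C + 1)) hq1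
    refine ⟨N, fun K hKN => ?_⟩
    rw [Real.dist_eq]
    have h1 := hC K
    have h2 : C * q ^ K ≤ C * q ^ N := mul_le_mul_of_nonneg_left (pow_le_pow_of_le_one hq0 hq1.le hKN) hC0
    have h3 : C * q ^ N < ε := by
      have := hN
      rw [lt_div_iff₀ (by linarith : (0 : ℝ) < C + 1)] at this
      nlinarith [pow_nonneg hq0 N]
    linarith
  exact (tendsto_add_atTop_iff_nat 1).1 hK

/-- **Energy conservation along the maximal exact flow of a robustly blowing-up table**: if
`NoGlobalCascade ε₀ α X₀` (`ε₀ > 0`, `α ∈ E₂(R)`), the maximal exact flow `X` on `[0,T⋆)`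
(`highShellBlowup_of_noGlobalCascade`: critical amplitude unbounded on shells `k → ∞`) conserves the total
energy `Σ_k ‖x_k(t)‖² = Σ_i X₀ᵢ²` for every `t < T⋆`.
[cite: Tao2016AveragedNS, §4 Thm. 4.2, (4.3), (4.12); Teschl2012, §2.6] -/
theorem energy_hasSum_of_noGlobalCascade {ε₀ R : ℝ} (hε : 0 < ε₀)
    {α : Fin m → Fin m → Fin m → ℤ × ℤ × ℤ → ℝ} {X₀ : Fin m → ℝ} (hα : InTableClass R α)
    (hNG : NoGlobalCascade ε₀ α X₀) :
    ∃ (T : ℝ) (X : Fin m → ℤ → ℝ → ℝ), 0 < T ∧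
      (∀ i n, ContDiffOn ℝ 1 (X i n) (Set.Ico 0 T)) ∧
      (∀ i n, X i n 0 = if n = 0 then X₀ i else 0) ∧
      (∀ i n t, n < 0 → X i n t = 0) ∧
      (∀ i n t, 0 ≤ t → t < T → derivWithin (X i n) (Set.Ici 0) t = quadTerm ε₀ α X i n t) ∧
      (∀ (K : ℤ) (L : ℝ), ∃ t : ℝ, 0 ≤ t ∧ t < T ∧
        ∃ (i : Fin m) (k : ℤ), K < k ∧ L < (1 + ε₀) ^ ((5 : ℝ) * k / 2) * |X i k t|) ∧
      (∀ t ∈ Ico (0 : ℝ) T, HasSum (fun k : ℕ => ‖shellVec X (k : ℤ) t‖ ^ 2) (∑ i, X₀ i ^ 2)) := by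
  obtain ⟨T, X, hT, h1, h2, h3, h4, h5, -, hhigh⟩ := highShellBlowup_of_noGlobalCascade hε hα hNG
  have hder : ∀ i k, ∀ τ ∈ Ico (0 : ℝ) T,
      HasDerivWithinAt (X i k) (quadTerm ε₀ α X i k τ) (Ici 0) τ := by
    intro i k τ hτ
    have hd : DifferentiableWithinAt ℝ (X i k) (Ico 0 T) τ :=
      ((h1 i k).differentiableOn one_ne_zero) τ hτ
    have hd' : DifferentiableWithinAt ℝ (X i k) (Ici 0) τ :=
      hd.mono_of_mem_nhdsWithin (by
        rw [mem_nhdsWithin]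
        exact ⟨Iio T, isOpen_Iio, hτ.2, fun x hx => ⟨hx.2, hx.1⟩⟩)
    rw [← h4 i k τ hτ.1 hτ.2]
    exact hd'.hasDerivWithinAt
  have hreg : ∀ T' : ℝ, T' < T → ∃ M : ℝ, ∀ τ ∈ Icc (0 : ℝ) T', ∀ (i : Fin m) (k : ℤ),
      (1 + (1 + ε₀) ^ ((10 : ℝ) * k)) * |X i k τ| ≤ M := by
    intro T' hT'
    rcases le_or_gt T' 0 with h0 | h0
    · obtain ⟨M, hM⟩ := h5 (T / 2) (by linarith) (by linarith)
      exact ⟨M, fun τ hτ i k => hM τ hτ.1 (by linarith [hτ.2]) i k⟩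
    · obtain ⟨M, hM⟩ := h5 T' h0 hT'
      exact ⟨M, fun τ hτ i k => hM τ hτ.1 hτ.2 i k⟩
  exact ⟨T, X, hT, h1, h2, h3, h4, hhigh, energy_hasSum hε hα.2.1 hder h2 h3 hreg⟩

end BlowupRigidityOne

end Summit.NavierStokesRegularity.NavierStokesRegularity.Theorems

end
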